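import Summits.ValiantsHypothesis.ValiantsHypothesis.Theorems.LacunarySymmetroidMatrixDescartesFiniteSectorRealisableSevenThree
import Summits.ValiantsHypothesis.ValiantsHypothesis.Theorems.LacunarySymmetroidMatrixDescartesFiniteSectorEtaTwoSix
import Summits.ValiantsHypothesis.ValiantsHypothesis.Theorems.LacunarySymmetroidMatrixDescartesFiniteSectorEtaKThreeSixSeven
import Summits.ValiantsHypothesis.ValiantsHypothesis.Theorems.LacunarySymmetroidMatrixDescartesFiniteSectorStampCeilingKThree

/-!
# `MatrixDescartes` — line «finite»: the `(7,3)` cell is EXACT on both sides in both currencies: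
# `ν(7,3) = 23` and `η(7,3) = 46` (by name)

HONEST FRAMING.  Object-search cell `pub-symmetroid`, seat val-sym-eng-3 g6 (census/instrument engine #3).  HELPER of
the crux item `stmt-ValiantsHypothesis-18050` (`Theses.LacunarySymmetroid.MatrixDescartes`, asymptotic in `K`) with NO
closure claim — register bookkeeping only, in the pattern of `…FiniteSectorEtaSixThree` (g5).  The seat's witness
`fullyRealisable_seven_015_twentythree` (`…FiniteSectorRealisableSevenThree`: a symmetric `7 × 7` half-pencil on the
extremal basis `(0,1,5)` — a lifted twin-allowed symmetric tropical design — with a full-positive-rooted determinant of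
degree `23`) is read against the kernel ceilings of the `K = 3` column:

* stamp currency: `stampLawAt_seven_three : StampLawAt 7 3 23` (`…FiniteSectorStampCeilingKThree`, T3) and, here,
  `not_stampLawAt_seven_three_22 : ¬ StampLawAt 7 3 22` — so **`ν(7,3) = 23 = n(7,2)`** exactly;
* sector currency: `hypRootLawAt_seven_three_46 : HypRootLawAt 7 3 46` (`…FiniteSectorEtaKThreeSixSeven`, gap-rule sieve)
  and, here, `not_hypRootLawAt_seven_three_45 : ¬ HypRootLawAt 7 3 45` by the PROVED doubling `u ↦ u²` (door-p5's adapter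
  `not_hypRootLawAt_of_fullyRealisable`, T2: an in-sector `(7,3)` pencil on `(0,2,10)` of degree `46`) — so
  **`η(7,3) = 46 = σ(7,3)`** exactly.

With `(2,3)` (dense), F4, F5, `(5,3)`, `(6,3)` and this cell the `K = 3` column of the instrument table of
`Cruxes/MatrixDescartes/Lines/finite.md` is exact on both sides, by name, for every `m ≤ 7`.  Nothing here bears on the
crux or on `VP ≠ VNP`.  [folklore] Descartes / postage-stamp bookkeeping; no citation exists or is needed.
-/

-- `Summit.ValiantsHypothesis.ValiantsHypothesis.…` repeats a component by the D-0017 layout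
-- (single-conjunct summit), which the `dupNamespace` linter flags; the name is mandated.
set_option linter.dupNamespace false

namespace Summit.ValiantsHypothesis.ValiantsHypothesis.Theorems.LacunarySymmetroidMatrixDescartes.FiniteSector

/-- **`ν(7,3) = 23` is EXACT: the ceiling `22` fails** (witness `fullyRealisable_seven_015_twentythree` on `(0,1,5)`).
[folklore] -/
theorem not_stampLawAt_seven_three_22 : ¬ StampLawAt 7 3 22 := by
  intro h
  obtain ⟨S, hS, hfull, hdeg⟩ := fullyRealisable_seven_015_twentythree
  have := h _ S hS hfull
  omega

/-- **`ν(7,3) = 23` EXACT on both sides** (`n(7,2) = 23`: ceiling `stampLawAt_seven_three`, floor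
`not_stampLawAt_seven_three_22`). [folklore] -/
theorem nu_seven_three_exact : StampLawAt 7 3 23 ∧ ¬ StampLawAt 7 3 22 :=
  ⟨stampLawAt_seven_three, not_stampLawAt_seven_three_22⟩

/-- **`η(7,3) ≥ 46`**: `¬ HypRootLawAt 7 3 45` — the doubled `(7,3)` realisation
(`fullyRealisable_seven_015_twentythree`): an in-sector (all roots real and simple) symmetric `(7,3)` pencil on `(0,2,10)`
of degree `46` (adapter `not_hypRootLawAt_of_fullyRealisable`, T2). [folklore] -/
theorem not_hypRootLawAt_seven_three_45 : ¬ HypRootLawAt 7 3 45 :=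
  not_hypRootLawAt_of_fullyRealisable fullyRealisable_seven_015_twentythree (by norm_num)

/-- **`η(7,3) = 46` EXACT on both sides** (`σ(7,3) = 46 = 2·n(7,2)`: ceiling `hypRootLawAt_seven_three_46`, floor
`not_hypRootLawAt_seven_three_45`). [folklore] -/
theorem eta_seven_three_exact : HypRootLawAt 7 3 46 ∧ ¬ HypRootLawAt 7 3 45 :=
  ⟨hypRootLawAt_seven_three_46, not_hypRootLawAt_seven_three_45⟩

end Summit.ValiantsHypothesis.ValiantsHypothesis.Theorems.LacunarySymmetroidMatrixDescartes.FiniteSector
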